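import Summits.QuantumFields.BalabanUV.Beta.EriceRemainderEnclosureHistoryAutonomyComparisonDualGauge

/-!
# EriceRemainderEnclosureHistoryAutonomyComparisonDualDeep — (E135a) **THE GAUGE IN THE DEEP REGION (base of the dual row induction).**  Setting of (E134)
# `…ComparisonDualGauge`: affine base `B u = β₀ + Σ_{k<K} L_k·u_k` (`β₀ > 0`, `L ≥ 0`, `L_0` free; floor, modulus, unique box solutions `S p`), `B′ ≥ B` with ISOTONE excess,
# one perturbed orbit `h′`, dual steps `X′_m = B′(tail_{m+1}h′) − B(tail_1 S h′_m)`, gauge `g_m = X′_m·h′_m²`.  **`deep_step`**: if the dual steps are non-negative from row `n`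
# on and the pin is DEEP (`K·(Σ_k L_k)·h′_{n+1}³ ≤ 1`) then `g_{n+1} ≤ g_n` — the window of (E133) `dual_row_ge` read through the SOURCE instead of the gauge
# (`δ_k ≤ Σ_{l<k} X′_{n+1+l} ≤ k·E_{n+1}`: `X′ ≤ E` under comparison, `E` antitone along the orbit) with `E_{n+1} ≤ 2X′_{n+1}` at a deep pin (the affine drop is at most half
# the excess there); per age the deficit is `≤ g_{n+1}·x_k∕2`, the first entry `≤ x_k∕2` per unit `h′_n²`, the share `≥ x_k`; **`gauge_of_row`** is the bookkeeping from the row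
# inequality to the gauge.  The sequel (E135b) `…ComparisonDualComparison` supplies the depth and runs the induction.

Cell `pub-balaban`, β-function sub-cell, BINDER row D4 «RemainderConst leaves for Bałaban's split» (`HOME/BINDER-OWNERS.md`; owner lineage `b2b-balaban-beta-an4`;
this file by co-owner #2 lineage `b2b-balaban-beta-d4-p2`, generation 104), β-FLOW TEAM duty (1), FREEZE (0) honoured (def-free; imports (E134) `…ComparisonDualGauge`; uses
(E133) `coupling_gap_le` ∕ `dual_two_pin_le` ∕ `dual_row_ge`, (E134) `steps_mul_le_rise` ∕ `cmp_from_pin` ∕ `step_le_excess` ∕ `source_chain` ∕ `pert_step_le_level`, (E132)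
`dual_step_eq_drop` ∕ `dual_gap_le_sum_steps`, (E48a) `family_zero` ∕ `strictAnti_of_memFlow` BY NAME; nothing restated).

HONEST FRAMING (page 1, verbatim and binding).  *"Discharging BetaPertH makes Bałaban's UV stability UNCONDITIONAL — a real constructive-QFT result; it is
NOT the continuum limit and NOT the Clay problem."*  THIS FILE DISCHARGES NOTHING OF THE KIND.  Elementary real analysis about ABSTRACT functionals on a box
]0,γ]^ℕ — hypotheses of a census, not facts; the form, signs, ages and moments of Bałaban's (1.22) limit functional are NOT PRINTED ([I] p. 298; GAPS
G-t4-U2-1∕-2) and NOT asserted.  Row D4 class UNCHANGED (critical-path width 0; instance 0∕1; D4 DISCHARGE NO DATE).  HONEST DEPENDENCY: continuum YM on T⁴ ⇐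
BetaPertH ∧ nine spine estimates (0/9 proved); BetaPertH ⇐ (D1) ∧ (D4) ∧ CAP+tail.  NOT CLAIMED here: the comparison theorem (the sequel); anything printed — NOT B12
Thm 2, NOT BetaPertH, NOT continuum, NOT Clay.

WHAT IS PROVED ([folklore]; 0 `def`, 0 sorry).  **`gauge_of_row`**, **`deep_step`**.
-/

noncomputable section
open Finset Set

namespace Summit.QuantumFields.BalabanUV.Beta.EriceRemainderEnclosureHistoryAutonomyComparisonDualDeep

open Literature.MathematicalPhysics.QuantumFieldTheory.Balaban1983to89
open Literature.MathematicalPhysics.QuantumFieldTheory.Balaban1983to89.T4BetaStationary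
open Literature.MathematicalPhysics.QuantumFieldTheory.Balaban1983to89.T4BetaFlowWellPosed
open Summit.QuantumFields.BalabanUV.Beta.EriceRemainderEnclosureHistoryAutonomyOrder
  (family_zero family_mem family_tail_eq family_succ_eq le_of_pin_le strictAnti_of_memFlow le_pin_of_memFlow)
open Summit.QuantumFields.BalabanUV.Beta.EriceRemainderEnclosureHistoryAutonomyComparisonDualOrbit
  (dual_step_eq_drop dual_source_antitone dual_gap_le_sum_steps cmp_of_dual_steps_nonneg)
open Summit.QuantumFields.BalabanUV.Beta.EriceRemainderEnclosureHistoryAutonomyComparisonDualRow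
  (coupling_gap_le dual_two_pin_le dual_row_ge)
open Summit.QuantumFields.BalabanUV.Beta.EriceRemainderEnclosureHistoryAutonomyComparisonDualGauge
  (steps_mul_le_rise cmp_from_pin step_le_excess source_chain pert_step_le_level gauge_step)

variable {B B' : (ℕ → ℝ) → ℝ} {M γ b β₀ : ℝ} {L : ℕ → ℝ} {K : ℕ} {S : ℝ → ℕ → ℝ} {h' : ℕ → ℝ}

/-! ## §1 The deep region: the window through the source, and the row -/

/-- **FROM THE ROW INEQUALITY TO THE GAUGE (pure bookkeeping).**  Dual steps `X0 = X′_n ≥ 0`, `X1 = X′_{n+1}`, squares `u0 = h′_n²`, `u1 = h′_{n+1}²`; the row inequality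
`X1 − X0·F − D ≤ X0` with the deficit `D ≤ X1·u1·C`, `u1·C < 1`; the row condition `F + u0·C ≤ u0·Σ` with the budget `Σ = Φ⁰ − β₀`, `Φ⁰ ≤ 1∕u1 − 1∕u0` (the base step at
the pin is below the perturbed one), `β₀ > 0`.  Then `X1·u1 ≤ X0·u0`. [folklore] -/
theorem gauge_of_row {X0 X1 u0 u1 F D C Sg Φ0 β₀ : ℝ} (hu0 : 0 < u0) (hu1 : 0 < u1) (hβ : 0 < β₀) (hX0 : 0 ≤ X0)
    (hrow : X1 - X0 * F - D ≤ X0) (hD : D ≤ X1 * u1 * C) (hC1 : u1 * C < 1) (hcond : F + u0 * C ≤ u0 * Sg)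
    (hSg : Sg = Φ0 - β₀) (hΦ0 : Φ0 ≤ 1 / u1 - 1 / u0) : X1 * u1 ≤ X0 * u0 := by
  have hbud : u0 * Sg ≤ u0 / u1 - 1 - u0 * β₀ := by
    rw [hSg]
    have h1 := mul_le_mul_of_nonneg_left hΦ0 hu0.le
    have e2 : u0 * (1 / u1 - 1 / u0) = u0 / u1 - 1 := by rw [mul_sub, mul_one_div, mul_one_div_cancel hu0.ne']
    rw [e2] at h1
    nlinarith [h1]
  have A1 : X1 - X1 * u1 * C ≤ X0 * (1 + F) := by nlinarith [hrow, hD]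
  have A2 : 1 + F ≤ u0 / u1 - u0 * C := by nlinarith [hcond, hbud, mul_pos hu0 hβ]
  have A3 : X1 - X1 * u1 * C ≤ X0 * (u0 / u1 - u0 * C) := A1.trans (mul_le_mul_of_nonneg_left A2 hX0)
  have A4 : X1 * u1 * (1 - u1 * C) ≤ X0 * u0 * (1 - u1 * C) := by
    have := mul_le_mul_of_nonneg_left A3 hu1.le
    have e1 : u1 * (X1 - X1 * u1 * C) = X1 * u1 * (1 - u1 * C) := by ring
    have e2 : u1 * (X0 * (u0 / u1 - u0 * C)) = X0 * u0 * (1 - u1 * C) := by field_simp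
    rw [e1, e2] at this; exact this
  exact le_of_mul_le_mul_right A4 (by linarith)

set_option maxHeartbeats 800000 in
/-- **THE GAUGE IN THE DEEP REGION.**  Same setting as (E134) `gauge_step`; here the dual steps are known non-negative from row `n` on (no gauge hypothesis above) and the
pin is DEEP: `K·(Σ_k L_k)·h′_{n+1}³ ≤ 1`.  Then `g_{n+1} ≤ g_n`.  PROOF: the window through the SOURCE instead of the gauge — `δ_k ≤ Σ_{l<k} X′_{n+1+l} ≤ k·E_{n+1}`
(`X′ ≤ E` under comparison, `E` antitone along the orbit) and `E_{n+1} ≤ 2·X′_{n+1}` (the affine drop at the deep pin is at most half the excess: `step_le_excess` reversed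
by `coupling_gap_le` and the depth); the deficit of age `k` becomes `2g_{n+1}·x_win(1 − x_win)·x_k ≤ g_{n+1}·x_k∕2`, the first entry is `≤ x_k∕2` per unit `u0`, and the
row closes against the share `x_k·ρ_k ≥ x_k` (`gauge_of_row`). [folklore] -/
theorem deep_step (hBaff : ∀ u, SeqBox γ u → B u = β₀ + ∑ k ∈ range K, L k * u k) (hβ : 0 < β₀) (hL : ∀ k, 0 ≤ L k)
    (hb : 0 < b)
    (hmono : ∀ u v : ℕ → ℝ, SeqBox γ u → SeqBox γ v → (∀ i, u i ≤ v i) → B u ≤ B v)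
    (hB : ∀ u u' : ℕ → ℝ, SeqBox γ u → SeqBox γ u' → ∀ D : ℝ, (∀ j, |u j - u' j| ≤ D) → |B u - B u'| ≤ M * D) (hM : 0 ≤ M)
    (hlo : ∀ u, SeqBox γ u → b ≤ B u)
    (hS : ∀ p, 0 < p → p ≤ γ → SeqBox γ (S p) ∧ MemFlow B p (S p))
    (huniq : ∀ p, 0 < p → p ≤ γ → ∀ u u' : ℕ → ℝ, SeqBox γ u → SeqBox γ u' → MemFlow B p u → MemFlow B p u' → u = u')
    (hexc : ∀ u, SeqBox γ u → B u ≤ B' u)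
    (hDmono : ∀ u v : ℕ → ℝ, SeqBox γ u → SeqBox γ v → (∀ i, u i ≤ v i) → B' u - B u ≤ B' v - B v)
    (hh' : SeqBox γ h') {y : ℝ} (hf' : MemFlow B' y h') (n : ℕ)
    (hX0 : 0 ≤ B' (fun i => h' (n + 1 + i)) - B (fun i => S (h' n) (1 + i)))
    (hXup : ∀ l, 0 ≤ B' (fun i => h' (n + 1 + l + 1 + i)) - B (fun i => S (h' (n + 1 + l)) (1 + i)))
    (hdeep : (K : ℝ) * (∑ k ∈ range K, L k) * h' (n + 1) ^ 3 ≤ 1) :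
    (B' (fun i => h' (n + 1 + 1 + i)) - B (fun i => S (h' (n + 1)) (1 + i))) * h' (n + 1) ^ 2
      ≤ (B' (fun i => h' (n + 1 + i)) - B (fun i => S (h' n) (1 + i))) * h' n ^ 2 := by
  -- derived facts
  have hmono' : ∀ u v : ℕ → ℝ, SeqBox γ u → SeqBox γ v → (∀ i, u i ≤ v i) → B' u ≤ B' v := fun u v hu hv hle => by
    linarith [hmono u v hu hv hle, hDmono u v hu hv hle]
  have hlo' : ∀ u, SeqBox γ u → b ≤ B' u := fun u hu => (hlo u hu).trans (hexc u hu)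
  have hanti : Antitone h' := (strictAnti_of_memFlow hb hlo' hh' hf').antitone
  have hpos : ∀ j, 0 < h' j := fun j => (hh' j).1
  have hcmp : ∀ l, h' (n + 1 + l) ≤ S (h' (n + 1)) l := cmp_from_pin (B' := B') hb hB hM hlo hS huniq hh' hf' (n + 1) hXup
  have hp1 := hh' (n + 1)
  have hpn := hh' n
  have hS1 := hS (h' (n + 1)) hp1.1 hp1.2
  have hSn := hS (h' n) hpn.1 hpn.2
  have hxpos : ∀ k, 0 < S (h' (n + 1)) k := fun k => (hS1.1 k).1
  have hx0 : S (h' (n + 1)) 0 = h' (n + 1) := family_zero hS hp1.1 hp1.2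
  have hxanti := (strictAnti_of_memFlow hb hlo hS1.1 hS1.2).antitone
  have hσanti := (strictAnti_of_memFlow hb hlo hSn.1 hSn.2).antitone
  have hxle0 : ∀ k, S (h' (n + 1)) k ≤ h' (n + 1) := fun k => by have := hxanti (Nat.zero_le k); rwa [hx0] at this
  set X0 : ℝ := B' (fun i => h' (n + 1 + i)) - B (fun i => S (h' n) (1 + i)) with hX0def
  set X1 : ℝ := B' (fun i => h' (n + 1 + 1 + i)) - B (fun i => S (h' (n + 1)) (1 + i)) with hX1def
  set E1 : ℝ := B' (fun i => h' (n + 1 + 1 + i)) - B (fun i => h' (n + 1 + 1 + i)) with hE1def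
  set u0 : ℝ := h' n ^ 2 with hu0
  set u1 : ℝ := h' (n + 1) ^ 2 with hu1
  set Mz : ℝ := ∑ k ∈ range K, L k with hMz
  have hMz0 : 0 ≤ Mz := sum_nonneg fun k _ => hL k
  have hu0p : 0 < u0 := pow_pos (hpos n) 2
  have hu1p : 0 < u1 := pow_pos (hpos (n + 1)) 2
  have hu10 : u1 ≤ u0 := pow_le_pow_left₀ (hpos _).le (hanti (Nat.le_succ n)) 2
  have hX1nn : 0 ≤ X1 := by have := hXup 0; simp only [Nat.add_zero] at this; exact this
  have hlev0 : X0 = 1 / h' (n + 1) ^ 2 - 1 / h' n ^ 2 - B (fun i => S (h' n) (1 + i)) := by rw [hX0def, hf'.2 n]; ring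
  have hlev1 : B' (fun i => h' (n + 1 + 1 + i)) = 1 / h' (n + 1 + 1) ^ 2 - 1 / h' (n + 1) ^ 2 := by rw [hf'.2 (n + 1)]; ring
  have hΦ00 : B (fun i => S (h' (n + 1)) (1 + i)) ≤ 1 / u1 := by
    have h1 : B (fun i => S (h' (n + 1)) (1 + i)) ≤ B' (fun i => h' (n + 1 + 1 + i)) := by linarith [hX1nn]
    have h2 := pert_step_le_level hmono' hb hlo' hh' hf' (m := n + 1) (by omega)
    rw [hlev1] at h1; simp only [hu1]; linarith
  -- M·h′_{n+1}³ ≤ 1 (from the depth; K = 0 gives M = 0)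
  have hM3 : Mz * h' (n + 1) ^ 3 ≤ 1 := by
    rcases Nat.eq_zero_or_pos K with hK | hK
    · have : Mz = 0 := by rw [hMz, hK, sum_range_zero]
      rw [this, zero_mul]; norm_num
    · have hK1 : (1 : ℝ) ≤ K := by exact_mod_cast hK
      have h3 : 0 ≤ Mz * h' (n + 1) ^ 3 := by have := hpos (n + 1); positivity
      nlinarith [hdeep]
  -- every dual step from row n+1 on is at most the excess there, hence at most E1
  have hXE : ∀ l, B' (fun i => h' (n + 1 + l + 1 + i)) - B (fun i => S (h' (n + 1 + l)) (1 + i)) ≤ E1 := by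
    intro l
    have hcl : ∀ q, h' (n + 1 + l + q) ≤ S (h' (n + 1 + l)) q :=
      cmp_from_pin (B' := B') hb hB hM hlo hS huniq hh' hf' (n + 1 + l) (fun q => by
        have := hXup (l + q); rw [show n + 1 + (l + q) = n + 1 + l + q by ring] at this; exact this)
    have h1 := step_le_excess (B' := B') hBaff hL hS hh' (n + 1 + l) hcl
    have h2 := source_chain (B := B) (B' := B') hDmono hh' hanti (n + 1) l
    exact h1.trans h2
  -- the window through the source: w_k²·δ_k ≤ k·E1·u1 … stated as δ_k ≤ k·E1
  have hwin : ∀ k, 1 / h' (n + 1 + k) ^ 2 - 1 / S (h' (n + 1)) k ^ 2 ≤ (k : ℝ) * E1 := by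
    intro k
    obtain ⟨_, hsum⟩ := dual_gap_le_sum_steps (B' := B') hb hmono hB hM hlo hS huniq hh' hf' (n + 1) k (fun l _ => hXup l)
    have := hsum.trans (sum_le_sum fun l _ => hXE l)
    rwa [sum_const, card_range, nsmul_eq_mul] at this
  -- the excess at the deep pin is at most twice the dual step: E1 ≤ 2·X1
  have hE2 : E1 ≤ 2 * X1 := by
    have hdrop := dual_step_eq_drop (B' := B') hBaff hS hh' (n + 1)
    -- X1 = E1 − Σ L_k (x_{1+k} − w_{1+k})
    have hterm : ∀ k ∈ range K, L k * (S (h' (n + 1)) (1 + k) - h' (n + 1 + 1 + k)) ≤ L k * ((K : ℝ) * u1 * h' (n + 1) / 2 * E1) := by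
      intro k hk
      have hkK : (k : ℝ) + 1 ≤ K := by exact_mod_cast Nat.succ_le_of_lt (mem_range.mp hk)
      refine mul_le_mul_of_nonneg_left ?_ (hL k)
      have hc' : 0 < h' (n + 1 + 1 + k) := hpos _
      have hcc : h' (n + 1 + 1 + k) ≤ S (h' (n + 1)) (1 + k) := by
        have := hcmp (1 + k); rwa [show n + 1 + (1 + k) = n + 1 + 1 + k by ring] at this
      have hgap := coupling_gap_le hc' hcc
      have hδ := hwin (1 + k)
      rw [show n + 1 + (1 + k) = n + 1 + 1 + k by ring] at hδ
      have hx := hxpos (1 + k)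
      have hE1nn : 0 ≤ E1 := hX1nn.trans (by have := hXE 0; simp only [Nat.add_zero] at this; exact this)
      -- (1/w² − 1/x²)·x²·w/2 ≤ (1+k)E1 · x² · x / 2 ≤ K E1 · u1 · h′/2
      have h1 : (1 / h' (n + 1 + 1 + k) ^ 2 - 1 / S (h' (n + 1)) (1 + k) ^ 2) * (S (h' (n + 1)) (1 + k) ^ 2 * h' (n + 1 + 1 + k) / 2)
          ≤ (((1 + k : ℕ) : ℝ) * E1) * (S (h' (n + 1)) (1 + k) ^ 2 * S (h' (n + 1)) (1 + k) / 2) :=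
        mul_le_mul hδ (by nlinarith [mul_le_mul_of_nonneg_left hcc (sq_nonneg (S (h' (n + 1)) (1 + k)))])
          (by positivity) (by positivity)
      have h2 : S (h' (n + 1)) (1 + k) ^ 2 * S (h' (n + 1)) (1 + k) ≤ u1 * h' (n + 1) := by
        have hl := hxle0 (1 + k)
        have : S (h' (n + 1)) (1 + k) ^ 2 ≤ u1 := by rw [hu1]; exact pow_le_pow_left₀ hx.le hl 2
        exact mul_le_mul this hl hx.le hu1p.le
      have h3 : (((1 + k : ℕ) : ℝ) * E1) * (S (h' (n + 1)) (1 + k) ^ 2 * S (h' (n + 1)) (1 + k) / 2) ≤ (K : ℝ) * u1 * h' (n + 1) / 2 * E1 := by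
        push_cast
        have : (1 + (k : ℝ)) * E1 ≤ (K : ℝ) * E1 := mul_le_mul_of_nonneg_right (by linarith) hE1nn
        nlinarith [mul_le_mul this h2 (by positivity) (by positivity)]
      linarith [hgap, h1, h3]
    have hsum := sum_le_sum hterm
    rw [← sum_mul] at hsum
    -- Σ L_k ≤ Mz and K·u1·h′/2·Mz ≤ 1/2
    have hhalf : Mz * ((K : ℝ) * u1 * h' (n + 1) / 2 * E1) ≤ E1 / 2 := by
      have hE1nn : 0 ≤ E1 := hX1nn.trans (by have := hXE 0; simp only [Nat.add_zero] at this; exact this)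
      have e : Mz * ((K : ℝ) * u1 * h' (n + 1) / 2 * E1) = ((K : ℝ) * Mz * h' (n + 1) ^ 3) * E1 / 2 := by simp only [hu1]; ring
      rw [e]; nlinarith [mul_le_mul_of_nonneg_right hdeep hE1nn]
    rw [← hMz] at hsum
    linarith [hdrop, hsum, hhalf]
  -- the row inequality and the deficit through the source window
  have hrow := dual_row_ge (B' := B') hBaff hβ.le hL hb hmono hB hM hlo hS huniq hDmono hh' hanti hf' n hcmp hXup
  rw [max_eq_left hX0] at hrow
  set C : ℝ := ∑ k ∈ range K, L k * (S (h' (n + 1)) k / 2) with hC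
  have hdef : ∑ k ∈ range K, L k * (S (h' (n + 1)) k ^ 3 * (1 / S (h' (n + 1)) (k + 1) ^ 2 - 1 / S (h' (n + 1)) k ^ 2)
        * (h' (n + 1 + k) ^ 2 * (1 / h' (n + 1 + k) ^ 2 - 1 / S (h' (n + 1)) k ^ 2))) ≤ X1 * u1 * C := by
    rw [hC, mul_sum]
    refine sum_le_sum fun k _ => ?_
    have hxk := hxpos k
    have hrise := steps_mul_le_rise hmono hb hlo hS1.1 hS1.2 k
    rw [hx0] at hrise
    have hΦk : 0 ≤ 1 / S (h' (n + 1)) (k + 1) ^ 2 - 1 / S (h' (n + 1)) k ^ 2 := by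
      rw [hS1.2.2 k]; linarith [hlo _ (seqBox_shift hS1.1 (k + 1))]
    have hwk : h' (n + 1 + k) ≤ S (h' (n + 1)) k := hcmp k
    have hw0 : 0 < h' (n + 1 + k) := hpos _
    -- w²δ ≤ x²·k·E1 ≤ x²·k·2X1
    have hwδ : h' (n + 1 + k) ^ 2 * (1 / h' (n + 1 + k) ^ 2 - 1 / S (h' (n + 1)) k ^ 2) ≤ S (h' (n + 1)) k ^ 2 * ((k : ℝ) * (2 * X1)) := by
      have hδ0 : 0 ≤ 1 / h' (n + 1 + k) ^ 2 - 1 / S (h' (n + 1)) k ^ 2 :=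
        sub_nonneg.mpr (one_div_le_one_div_of_le (pow_pos hw0 2) (pow_le_pow_left₀ hw0.le hwk 2))
      have h1 : (k : ℝ) * E1 ≤ (k : ℝ) * (2 * X1) := mul_le_mul_of_nonneg_left hE2 (Nat.cast_nonneg k)
      exact mul_le_mul (pow_le_pow_left₀ hw0.le hwk 2) ((hwin k).trans h1) hδ0 (by positivity)
    -- x³Φ⁰·(x²·k·2X1) = 2X1·x⁵·(kΦ⁰) ≤ 2X1·x⁵(1/x² − 1/u1) = 2X1·x³(1 − x²/u1) ≤ X1·u1·x/2
    have step1 : S (h' (n + 1)) k ^ 3 * (1 / S (h' (n + 1)) (k + 1) ^ 2 - 1 / S (h' (n + 1)) k ^ 2)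
        * (h' (n + 1 + k) ^ 2 * (1 / h' (n + 1 + k) ^ 2 - 1 / S (h' (n + 1)) k ^ 2))
        ≤ S (h' (n + 1)) k ^ 3 * (1 / S (h' (n + 1)) (k + 1) ^ 2 - 1 / S (h' (n + 1)) k ^ 2) * (S (h' (n + 1)) k ^ 2 * ((k : ℝ) * (2 * X1))) :=
      mul_le_mul_of_nonneg_left hwδ (by positivity)
    have step2 : S (h' (n + 1)) k ^ 5 * ((k : ℝ) * (1 / S (h' (n + 1)) (k + 1) ^ 2 - 1 / S (h' (n + 1)) k ^ 2))
        ≤ S (h' (n + 1)) k ^ 5 * (1 / S (h' (n + 1)) k ^ 2 - 1 / h' (n + 1) ^ 2) :=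
      mul_le_mul_of_nonneg_left hrise (by positivity)
    have e3 : S (h' (n + 1)) k ^ 5 * (1 / S (h' (n + 1)) k ^ 2 - 1 / h' (n + 1) ^ 2)
        = u1 * S (h' (n + 1)) k * ((S (h' (n + 1)) k ^ 2 / u1) * (1 - S (h' (n + 1)) k ^ 2 / u1)) := by
      have hne : h' (n + 1) ≠ 0 := (hpos _).ne'
      simp only [hu1]; field_simp
    have hq : (S (h' (n + 1)) k ^ 2 / u1) * (1 - S (h' (n + 1)) k ^ 2 / u1) ≤ 1 / 4 := by
      nlinarith [sq_nonneg (S (h' (n + 1)) k ^ 2 / u1 - 1 / 2)]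
    have step3 : S (h' (n + 1)) k ^ 5 * (1 / S (h' (n + 1)) k ^ 2 - 1 / h' (n + 1) ^ 2) ≤ u1 * S (h' (n + 1)) k * (1 / 4) := by
      rw [e3]; exact mul_le_mul_of_nonneg_left hq (by positivity)
    have step4 := mul_le_mul_of_nonneg_left (step2.trans step3) (by positivity : (0 : ℝ) ≤ 2 * X1)
    have hk : S (h' (n + 1)) k ^ 3 * (1 / S (h' (n + 1)) (k + 1) ^ 2 - 1 / S (h' (n + 1)) k ^ 2)
        * (h' (n + 1 + k) ^ 2 * (1 / h' (n + 1 + k) ^ 2 - 1 / S (h' (n + 1)) k ^ 2)) ≤ X1 * u1 * (S (h' (n + 1)) k / 2) :=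
      calc _ ≤ S (h' (n + 1)) k ^ 3 * (1 / S (h' (n + 1)) (k + 1) ^ 2 - 1 / S (h' (n + 1)) k ^ 2) * (S (h' (n + 1)) k ^ 2 * ((k : ℝ) * (2 * X1))) := step1
        _ = 2 * X1 * (S (h' (n + 1)) k ^ 5 * ((k : ℝ) * (1 / S (h' (n + 1)) (k + 1) ^ 2 - 1 / S (h' (n + 1)) k ^ 2))) := by ring
        _ ≤ 2 * X1 * (u1 * S (h' (n + 1)) k * (1 / 4)) := step4
        _ = X1 * u1 * (S (h' (n + 1)) k / 2) := by ring
    have := mul_le_mul_of_nonneg_left hk (hL k)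
    linarith [this]
  -- u1·C ≤ M·h′_{n+1}³∕2 ≤ 1∕2
  have hC1 : u1 * C < 1 := by
    have hle : C ≤ Mz * (h' (n + 1) / 2) := by
      rw [hC, hMz, sum_mul]
      exact sum_le_sum fun k _ => mul_le_mul_of_nonneg_left (by linarith [hxle0 k]) (hL k)
    have h1 := mul_le_mul_of_nonneg_left hle hu1p.le
    have e : u1 * (Mz * (h' (n + 1) / 2)) = Mz * h' (n + 1) ^ 3 / 2 := by simp only [hu1]; ring
    rw [e] at h1
    linarith [hM3]
  -- the row condition: first entry ≤ x_k/2 per unit u0, deficit ≤ x_k/2, share ≥ x_k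
  have hle1 : h' (n + 1) ≤ S (h' n) 1 := by
    have hσ1 := (hSn.1 1).1
    refine (pow_le_pow_iff_left₀ (hpos (n + 1)).le hσ1.le two_ne_zero).mp
      ((one_div_le_one_div (pow_pos hσ1 2) (pow_pos (hpos (n + 1)) 2)).mp ?_)
    have : 0 ≤ 1 / h' (n + 1) ^ 2 - 1 / h' n ^ 2 - B (fun i => S (h' n) (1 + i)) := by rw [← hlev0]; exact hX0
    have e2 : 1 / S (h' n) (0 + 1) ^ 2 = 1 / S (h' n) 0 ^ 2 + B (fun i => S (h' n) (0 + 1 + i)) := hSn.2.2 0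
    rw [family_zero hS hpn.1 hpn.2] at e2
    have e3 : (fun i => S (h' n) (0 + 1 + i)) = (fun i => S (h' n) (1 + i)) := by funext i; simp
    rw [e3] at e2; simp only [Nat.zero_add] at e2
    linarith
  have hcond : ∑ k ∈ range K, L k * (S (h' n) (1 + k) ^ 2 * S (h' (n + 1)) k / 2) + u0 * C
      ≤ u0 * ∑ k ∈ range K, L k * S (h' n) (1 + k) := by
    rw [hC, mul_sum, mul_sum, ← sum_add_distrib]
    refine sum_le_sum fun k _ => ?_
    have hxk := hxpos k
    have hσ := (hSn.1 (1 + k)).1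
    obtain ⟨hρ0, _⟩ := dual_two_pin_le hb hmono hB hM hlo hS huniq hh' n hle1 k
    -- (S h′_n)_{1+k} ≤ h′_n, so S² ≤ u0
    have hθ : S (h' n) (1 + k) ^ 2 ≤ u0 := by
      have : S (h' n) (1 + k) ≤ S (h' n) 0 := hσanti (Nat.zero_le _)
      rw [family_zero hS hpn.1 hpn.2] at this
      exact pow_le_pow_left₀ hσ.le this 2
    have h1 : S (h' n) (1 + k) ^ 2 * S (h' (n + 1)) k / 2 ≤ u0 * S (h' (n + 1)) k / 2 := by
      have := mul_le_mul_of_nonneg_right hθ hxk.le; linarith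
    have h2 : u0 * S (h' (n + 1)) k ≤ u0 * S (h' n) (1 + k) := mul_le_mul_of_nonneg_left (by linarith) hu0p.le
    have hLk := hL k
    nlinarith [mul_le_mul_of_nonneg_left (show S (h' n) (1 + k) ^ 2 * S (h' (n + 1)) k / 2 + u0 * (S (h' (n + 1)) k / 2) ≤ u0 * S (h' n) (1 + k) by linarith) hLk]
  -- conclude by the bookkeeping lemma
  have hSg : ∑ k ∈ range K, L k * S (h' n) (1 + k) = B (fun i => S (h' n) (1 + i)) - β₀ := by
    rw [hBaff _ (fun i => hSn.1 (1 + i))]; ring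
  have hΦ0 : B (fun i => S (h' n) (1 + i)) ≤ 1 / u1 - 1 / u0 := by rw [hlev0] at hX0; simp only [hu0, hu1]; linarith
  exact gauge_of_row hu0p hu1p hβ hX0 hrow hdef hC1 hcond hSg hΦ0

end Summit.QuantumFields.BalabanUV.Beta.EriceRemainderEnclosureHistoryAutonomyComparisonDualDeep

end
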